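import Literature.Analysis.FluidPDE.PlanarJunctionAgreement
import Literature.Analysis.FluidPDE.PlanarTypedChain2
import HarnessLib

/-!
# Junction agreement, second layer: junctions touching sheared diagonal graph bands

Topic `Literature/Analysis/FluidPDE`. `PlanarJunctionAgreement.lean` decides, for a first-layer
phase, that consecutive element scalars and stream functions agree on the agreement slabs of the
junctions (`PhaseQ.agreeB`, `fields_eq_of_agreeB`, `agreement_of_agreeB`). For a second-layer phase
`P : PhaseQ2` (`PlanarTypedChain2.lean`) the MATERIAL data are read on the first-layer view
`P.toPhase` (a sheared band replaced by the diagonal band of its data, same `Ξ`), so every junction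
is first tested there; a junction touching a sheared node passes the additional finite test
`shJuncOKB`: the slope of `Ξ` in the junction's material gap is constant in the clock, and the gap
contains the zone widened by `μ = |sh| · B` where `B` bounds the transverse offset `|v - T(u)|` over
the inner box of the junction partner (a certified bound of an affine functional over a box with
clock-affine corners). On the agreement region — the slab intersected with the two open inner boxes
(`Agree2`) — the sheared scalar / stream function then coincide with those of its data
(`SDgQ.scalar_eq_dScalar`, `stream_eq_dStream`: the material abscissa `ξ = u + sh (v - T(u))` stays in
the gap), whence the agreement of the second-layer phase (`fields_eq_of_agreeB2`,
`agreement_of_agreeB2`) and, with the geometric checks read on the proxy `P.geoPhase`, the interior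
facts of a checked second-layer phase (`transport_of_checks2`, …).

Folklore; no named facts. Infrastructure towards a discharge of `acm_compatible_blocks`
(`QuasiSelfSimilarCompatibleBlocks.lean`).

## References

* G. Alberti, G. Crippa, A. L. Mazzucato, *Exponential self-similar mixing by incompressible
  flows*, J. Amer. Math. Soc. 32 (2019), 445–490, §7 (arXiv:1605.02090).
-/

noncomputable section

open Function Set Filter
open scoped Topology ContDiff

namespace Literature.Analysis.FluidPDE

namespace PlanarKinematics

open Gluing

/-- The plane `ℝ²` as a Euclidean space. [folklore] -/
local notation "E²" => EuclideanSpace ℝ (Fin 2)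

/-! ## Constancy across a material gap whose slope is constant in the clock -/

namespace Pw

variable {F : Pw}

/-- The rate of the gap slope datum is the base rate plus the rates of the jumps before the gap.
[folklore] -/
theorem rate_WAff (F : Pw) (m : ℕ) : (F.WAff m).rate = F.s.rate + (((F.kinks.take m).map Kink.J).map Aff.rate).sum := by
  simp only [WAff]
  induction (F.kinks.take m).map Kink.J with
  | nil => simp
  | cons a l ih => rw [List.foldr_cons, Aff.rate_add, ih, List.map_cons, List.sum_cons]; ring

/-- **On a gap, the clock derivative datum `gapDα` is affine in `u` with slope the rate of the gap
slope.** [folklore] -/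
theorem gapDα_sub (F : Pw) (m : ℕ) (α u u' : ℝ) : F.gapDα m α u' - F.gapDα m α u = (F.WAff m).rate * (u' - u) := by
  rw [rate_WAff]
  simp only [gapDα]
  have key : ∀ L : List Kink,
      (L.map fun k => k.J.rate * (u' - k.b.eval α - k.ℓ / 2) - k.J.eval α * k.b.rate).sum -
        (L.map fun k => k.J.rate * (u - k.b.eval α - k.ℓ / 2) - k.J.eval α * k.b.rate).sum =
      ((L.map Kink.J).map Aff.rate).sum * (u' - u) := by
    intro L
    induction L with
    | nil => simp
    | cons k L ih => simp only [List.map_cons, List.sum_cons]; linear_combination ih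
  linear_combination key (F.kinks.take m)

/-- If the gap slope datum is constant in the clock, `gapDα` does not depend on `u`. [folklore] -/
theorem gapDα_eq_of_isConstB {m : ℕ} (h : (F.WAff m).isConstB = true) (α u u' : ℝ) : F.gapDα m α u' = F.gapDα m α u := by
  have hr : (F.WAff m).rate = 0 := by
    simp only [Aff.isConstB, decide_eq_true_eq] at h
    simp [Aff.rate, h]
  have h2 := F.gapDα_sub m α u u'
  rw [hr, zero_mul] at h2
  exact (sub_eq_zero.1 h2)

variable {t₀ τ : ℝ}

/-- **Across a gap the clocked slope is constant in `u`.** [folklore] -/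
theorem cdu_eq_of_inGap (hF : F.LenPos) {m : ℕ} {t u u' : ℝ} (hu : F.InGap m (clock t₀ τ t) u)
    (hu' : F.InGap m (clock t₀ τ t) u') : F.cdu t₀ τ t u' = F.cdu t₀ τ t u := by
  simp only [Pw.cdu, F.du_eq_W hF hu, F.du_eq_W hF hu']

/-- **Across a gap whose slope is constant in the clock, the clocked time derivative is constant in
`u`.** [folklore] -/
theorem cdt_eq_of_inGap (hF : F.LenPos) {m : ℕ} (hc : (F.WAff m).isConstB = true) {t u u' : ℝ}
    (hu : F.InGap m (clock t₀ τ t) u) (hu' : F.InGap m (clock t₀ τ t) u') : F.cdt t₀ τ t u' = F.cdt t₀ τ t u := by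
  simp only [Pw.cdt, F.dα_eq_gapDα hF hu, F.dα_eq_gapDα hF hu', F.gapDα_eq_of_isConstB hc _ u u']

end Pw

namespace DgQ

variable {d : DgQ} {t₀ τ : ℝ}

/-- **The axial rate is constant across a material gap whose slope is constant in the clock.**
[folklore] -/
theorem g_eq_of_inGap (hv : d.validB = true) {m : ℕ} (hc : (d.Ξ.WAff m).isConstB = true) {t u u' : ℝ}
    (hu : d.Ξ.InGap m (clock t₀ τ t) u) (hu' : d.Ξ.InGap m (clock t₀ τ t) u') : d.g t₀ τ t u' = d.g t₀ τ t u := by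
  have hF : d.Ξ.LenPos := Pw.lenPos_of_matValidB (matValid_of_validB hv)
  simp only [DgQ.g, axialRate, Pw.cdu_eq_of_inGap hF hu hu', Pw.cdt_eq_of_inGap hF hc hu hu']

end DgQ

/-! ## Bound of an affine functional over a box with clock-affine corners -/

namespace LinFun

variable (φ : LinFun)

/-- The value of a lab functional with constant coefficients at a corner `(x, y)` given by clock-affine
data. [folklore] -/
def cornerAff (x y : Aff) : Aff := ((x.smul φ.f0).add (y.smul φ.f1)).add φ.g

/-- Evaluation of the corner datum. [folklore] -/
theorem eval_cornerAff (x y : Aff) (α : ℝ) : (φ.cornerAff x y).eval α = φ.f0 * x.eval α + φ.f1 * y.eval α + φ.g.eval α := by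
  simp only [cornerAff, Aff.eval_add, Aff.eval_smul]

/-- **Certified bound of `|φ|` over a box**: the maximum over the four corners of the absolute bounds
of the corner data on the clock interval. [folklore] -/
def boxBound (φ : LinFun) (B : BoxQ) : ℚ :=
  max (max (φ.cornerAff B.a₀ B.a₁).absMax (φ.cornerAff B.a₀ B.b₁).absMax)
    (max (φ.cornerAff B.b₀ B.a₁).absMax (φ.cornerAff B.b₀ B.b₁).absMax)

/-- **Soundness of the box bound**: on the closed box `[a₀(α), b₀(α)] × [a₁(α), b₁(α)]`,
`|φ_α(z)| ≤ boxBound`. [folklore] -/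
theorem abs_eval_le_boxBound (B : BoxQ) {α : ℝ} (hα : α ∈ Icc (0 : ℝ) 1) {z : E²}
    (h0 : z 0 ∈ Icc (B.a₀.eval α) (B.b₀.eval α)) (h1 : z 1 ∈ Icc (B.a₁.eval α) (B.b₁.eval α)) :
    |φ.eval α z| ≤ φ.boxBound B := by
  -- `φ` is affine in `z`: its value lies between the min and the max of the corner values
  have hc : ∀ x y : Aff, |(φ.cornerAff x y).eval α| ≤ (φ.cornerAff x y).absMax := fun x y => Aff.abs_eval_le _ hα
  have hb : ∀ x y : Aff, ((φ.cornerAff x y).absMax : ℝ) ≤ φ.boxBound B →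
      -(φ.boxBound B : ℝ) ≤ φ.f0 * x.eval α + φ.f1 * y.eval α + φ.g.eval α ∧
        φ.f0 * x.eval α + φ.f1 * y.eval α + φ.g.eval α ≤ φ.boxBound B := by
    intro x y hle
    have h := abs_le.1 ((hc x y).trans hle)
    rw [eval_cornerAff] at h
    exact h
  have e1 : ((φ.cornerAff B.a₀ B.a₁).absMax : ℝ) ≤ φ.boxBound B := by
    simp only [boxBound]; exact_mod_cast le_max_of_le_left (le_max_left _ _)
  have e2 : ((φ.cornerAff B.a₀ B.b₁).absMax : ℝ) ≤ φ.boxBound B := by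
    simp only [boxBound]; exact_mod_cast le_max_of_le_left (le_max_right _ _)
  have e3 : ((φ.cornerAff B.b₀ B.a₁).absMax : ℝ) ≤ φ.boxBound B := by
    simp only [boxBound]; exact_mod_cast le_max_of_le_right (le_max_left _ _)
  have e4 : ((φ.cornerAff B.b₀ B.b₁).absMax : ℝ) ≤ φ.boxBound B := by
    simp only [boxBound]; exact_mod_cast le_max_of_le_right (le_max_right _ _)
  obtain ⟨l1, u1⟩ := hb _ _ e1; obtain ⟨l2, u2⟩ := hb _ _ e2; obtain ⟨l3, u3⟩ := hb _ _ e3; obtain ⟨l4, u4⟩ := hb _ _ e4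
  rw [abs_le, LinFun.eval]
  -- write `z` as a convex combination along each axis
  obtain ⟨ha0, hb0⟩ := h0; obtain ⟨ha1, hb1⟩ := h1
  set X := z 0; set Y := z 1
  set A0 := B.a₀.eval α; set B0 := B.b₀.eval α; set A1 := B.a₁.eval α; set B1 := B.b₁.eval α
  set f0 : ℝ := (φ.f0 : ℝ); set f1 : ℝ := (φ.f1 : ℝ); set g0 := φ.g.eval α; set M : ℝ := (φ.boxBound B : ℝ)
  -- bound the `f0 * X` part by the two ends, then the `f1 * Y` part
  have hX : min (f0 * A0) (f0 * B0) ≤ f0 * X ∧ f0 * X ≤ max (f0 * A0) (f0 * B0) := by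
    rcases le_total 0 f0 with hf | hf
    · exact ⟨(min_le_left _ _).trans (mul_le_mul_of_nonneg_left ha0 hf), (mul_le_mul_of_nonneg_left hb0 hf).trans (le_max_right _ _)⟩
    · exact ⟨(min_le_right _ _).trans (mul_le_mul_of_nonpos_left hb0 hf), (mul_le_mul_of_nonpos_left ha0 hf).trans (le_max_left _ _)⟩
  have hY : min (f1 * A1) (f1 * B1) ≤ f1 * Y ∧ f1 * Y ≤ max (f1 * A1) (f1 * B1) := by
    rcases le_total 0 f1 with hf | hf
    · exact ⟨(min_le_left _ _).trans (mul_le_mul_of_nonneg_left ha1 hf), (mul_le_mul_of_nonneg_left hb1 hf).trans (le_max_right _ _)⟩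
    · exact ⟨(min_le_right _ _).trans (mul_le_mul_of_nonpos_left hb1 hf), (mul_le_mul_of_nonpos_left ha1 hf).trans (le_max_left _ _)⟩
  constructor
  · rcases min_choice (f0 * A0) (f0 * B0) with hm0 | hm0 <;> rcases min_choice (f1 * A1) (f1 * B1) with hm1 | hm1 <;>
      [linarith [hX.1, hY.1]; linarith [hX.1, hY.1]; linarith [hX.1, hY.1]; linarith [hX.1, hY.1]]
  · rcases max_choice (f0 * A0) (f0 * B0) with hm0 | hm0 <;> rcases max_choice (f1 * A1) (f1 * B1) with hm1 | hm1 <;>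
      [linarith [hX.2, hY.2]; linarith [hX.2, hY.2]; linarith [hX.2, hY.2]; linarith [hX.2, hY.2]]

/-- The inner box at clock `α` lies in the closed corner box. [folklore] -/
theorem mem_cornerBox_of_mem_inner {B : BoxQ} (hρ : 0 ≤ (B.ρ : ℝ)) {α : ℝ} {z : E²} (hz : z ∈ (B.frzAt α).inner) :
    z 0 ∈ Icc (B.a₀.eval α) (B.b₀.eval α) ∧ z 1 ∈ Icc (B.a₁.eval α) (B.b₁.eval α) := by
  simp only [BoxPlateau.inner, BoxQ.frzAt, mem_setOf_eq] at hz
  obtain ⟨h1, h2, h3, h4⟩ := hz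
  exact ⟨⟨by linarith, by linarith⟩, ⟨by linarith, by linarith⟩⟩

end LinFun

/-! ## The side test of a sheared node at a junction -/

namespace SDgQ

variable (s : SDgQ)

/-- **Rational line data of the static profile on the line gap `mT`**: intercept and slope, when the
folded intercept is available and both are constant in the clock. [folklore] -/
def lineData (s : SDgQ) (mT : ℕ) : Option (ℚ × ℚ) :=
  match s.d.T.CgapO mT with
  | some C => if C.isConstB && (s.d.T.WAff mT).isConstB then some (C.v0, (s.d.T.WAff mT).v0) else none
  | none => none

/-- **Offset functional** `z ↦ v(z) - (C + W u(z))` of the sheared node for line data `(C, W)` (lab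
coordinates, constant coefficients). [folklore] -/
def offsetFun (s : SDgQ) (C W : ℚ) : LinFun :=
  ⟨(ElemQ.dg s.d).vC.1 - W * (ElemQ.dg s.d).uC.1, (ElemQ.dg s.d).vC.2 - W * (ElemQ.dg s.d).uC.2, Aff.const (-C)⟩

/-- Evaluation of the offset functional. [folklore] -/
theorem offsetFun_eval (C W : ℚ) (α : ℝ) (z : E²) :
    (s.offsetFun C W).eval α z = (ElemQ.dg s.d).vOf z - ((C : ℝ) + W * (ElemQ.dg s.d).uOf z) := by
  simp only [offsetFun, LinFun.eval, ElemQ.vOf, ElemQ.uOf, Aff.eval_const]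
  push_cast; ring

variable {s}

/-- **The line of the static profile on its line gap is the rational line.** [folklore] -/
theorem line_eq_of_lineData (hv : s.validB = true) {mT : ℕ} {C W : ℚ} (h : s.lineData mT = some (C, W)) {α u : ℝ}
    (hg : s.d.T.InGap mT α u) : (ElemQ.dg s.d).line α u = C + W * u := by
  have hT : s.d.T.LenPos := DgQ.lenPosT_of_validB (validD_of_validB hv)
  simp only [lineData] at h
  cases hC : s.d.T.CgapO mT with
  | none => rw [hC] at h; simp at h
  | some A =>
    rw [hC] at h
    simp only at h
    split_ifs at h with hc
    simp only [Option.some.injEq, Prod.mk.injEq] at h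
    obtain ⟨rfl, rfl⟩ := h
    simp only [Bool.and_eq_true] at hc
    rw [ElemQ.line, s.d.T.val_eq_gapVal hT hg, Pw.gapVal_eq, ← s.d.T.eval_CgapO hC, ← Pw.eval_WAff,
      Aff.eval_of_isConstB hc.1, Aff.eval_of_isConstB hc.2]

/-- **Side test of a sheared node at a junction** with zone `[za, zb]`, line regime `mT`, material gap
`mΞ`, against the box `B` of its junction partner: line data available, the gap slope of `Ξ` constant
in the clock, and the zone widened by `μ = |sh| · boxBound` inside the material gap. [folklore] -/
def shSideOKB (s : SDgQ) (mT mΞ : ℕ) (za zb : Aff) (B : BoxQ) : Bool :=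
  match s.lineData mT with
  | none => false
  | some (C, W) =>
    (s.d.Ξ.WAff mΞ).isConstB &&
      s.d.Ξ.regOKB (.gap mΞ) (za.sub (Aff.const (|s.sh| * (s.offsetFun C W).boxBound B)))
        (zb.add (Aff.const (|s.sh| * (s.offsetFun C W).boxBound B))) &&
      decide (0 ≤ B.ρ)

/-- **Soundness of the side test**: at a point of the junction partner's inner box whose abscissa lies
in the zone and in the line gap, the sheared scalar and stream function are those of the node's
diagonal-band data. [folklore] -/
theorem fields_eq_d_of_shSideOKB (hv : s.validB = true) {mT mΞ : ℕ} {za zb : Aff} {B : BoxQ}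
    (h : s.shSideOKB mT mΞ za zb B = true) {t₀ τ t : ℝ} {z : E²}
    (hline : s.d.T.InGap mT (clock t₀ τ t) ((ElemQ.dg s.d).uOf z))
    (hu : (ElemQ.dg s.d).uOf z ∈ Icc (za.eval (clock t₀ τ t)) (zb.eval (clock t₀ τ t)))
    (hz : z ∈ (B.frzAt (clock t₀ τ t)).inner) (G : ℝ → ℝ) :
    s.scalar t₀ τ G t z = s.d.scalar t₀ τ G t z ∧ s.stream t₀ τ t z = s.d.stream t₀ τ t z := by
  set α := clock t₀ τ t with hα
  have hαI : α ∈ Icc (0 : ℝ) 1 := clock_mem_Icc t₀ τ t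
  have hvd := validD_of_validB hv
  have hF : s.d.Ξ.LenPos := Pw.lenPos_of_matValidB (DgQ.matValid_of_validB hvd)
  simp only [shSideOKB] at h
  cases hL : s.lineData mT with
  | none => rw [hL] at h; simp at h
  | some CW =>
    obtain ⟨C, W⟩ := CW
    rw [hL] at h
    simp only [Bool.and_eq_true, decide_eq_true_eq] at h
    obtain ⟨⟨hc, hreg⟩, hρ⟩ := h
    set μ : ℝ := ((|s.sh| * (s.offsetFun C W).boxBound B : ℚ) : ℝ) with hμ
    set u := (ElemQ.dg s.d).uOf z with hudef
    set w := diagFrame ((d4Frame s.d.o).app z) with hw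
    have hw0 : w 0 = u := by rw [hudef, ElemQ.uOf_dg]
    have hw1 : w 1 = (ElemQ.dg s.d).vOf z := by rw [ElemQ.vOf_dg]
    -- the transverse offset is the offset functional, bounded over the box
    have hTf : s.Tf (w 0) = C + W * u := by
      rw [hw0, SDgQ.Tf, ← Pw.cval_static (t₀ := t₀) (τ := τ) (static_of_validB hv) t u]
      have := line_eq_of_lineData hv hL hline
      simpa [ElemQ.line, Pw.cval] using this
    have hoff : w 1 - s.Tf (w 0) = (s.offsetFun C W).eval α z := by
      rw [hTf, hw1, offsetFun_eval]
    have hρ' : 0 ≤ (B.ρ : ℝ) := by exact_mod_cast hρ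
    obtain ⟨hb0, hb1⟩ := LinFun.mem_cornerBox_of_mem_inner hρ' hz
    have hbound : |(s.sh : ℝ)| * |w 1 - s.Tf (w 0)| ≤ μ := by
      rw [hoff, hμ]; push_cast
      exact mul_le_mul_of_nonneg_left ((s.offsetFun C W).abs_eval_le_boxBound B hαI hb0 hb1) (abs_nonneg _)
    -- the widened interval lies in the material gap
    have hgap : ∀ u' ∈ Icc (u - μ) (u + μ), s.d.Ξ.InGap mΞ α u' := by
      intro u' hu'
      have hR := s.d.Ξ.regOK_of_regOKB (reg := .gap mΞ) hreg hαI
      refine s.d.Ξ.inGap_of_regOK hR ⟨?_, ?_⟩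
      · rw [Aff.eval_sub, Aff.eval_const]; linarith [hu.1, hu'.1]
      · rw [Aff.eval_add, Aff.eval_const]; linarith [hu.2, hu'.2]
    have hu0 : s.d.Ξ.InGap mΞ α u := hgap u ⟨by linarith [show (0:ℝ) ≤ μ from le_trans (by positivity) hbound],
      by linarith [show (0:ℝ) ≤ μ from le_trans (by positivity) hbound]⟩
    have hW : ∀ u' ∈ Icc (u - μ) (u + μ), s.d.Ξ.cdu t₀ τ t u' = s.d.Ξ.cdu t₀ τ t u :=
      fun u' hu' => Pw.cdu_eq_of_inGap hF hu0 (hgap u' hu')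
    have hG : ∀ u' ∈ Icc (u - μ) (u + μ), s.d.g t₀ τ t u' = s.d.g t₀ τ t u :=
      fun u' hu' => DgQ.g_eq_of_inGap hvd hc hu0 (hgap u' hu')
    refine ⟨scalar_eq_dScalar hv G ?_, stream_eq_dStream hv ?_⟩
    · have := cdu_shAbscissa_eq (e := s) (t₀ := t₀) (τ := τ) (t := t) hw0 hW hbound
      rw [hw0] at this ⊢; exact this
    · have := g_shAbscissa_eq (e := s) (t₀ := t₀) (τ := τ) (t := t) hw0 hG hbound
      rw [hw0] at this ⊢; exact this

end SDgQ

/-! ## The junction check of a second-layer phase -/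

namespace PhaseQ2

variable (P : PhaseQ2)

/-- **Agreement region of junction `j`**: the agreement slab of the material view intersected with the
open inner boxes of the two nodes. [folklore] -/
def Agree2 (P : PhaseQ2) (j : ℕ) : Set (ℝ × E²) :=
  P.toPhase.Agree j ∩ {p | p.2 ∈ ((P.node j).box.frzAt (clock P.T0 P.Tau p.1)).inner ∧
    p.2 ∈ ((P.node (j + 1)).box.frzAt (clock P.T0 P.Tau p.1)).inner}

/-- The open inner box of a node as a space-time set is open. [folklore] -/
theorem isOpen_innerST (B : BoxQ) : IsOpen {p : ℝ × E² | p.2 ∈ (B.frzAt (clock P.T0 P.Tau p.1)).inner} := by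
  have hc : ∀ a : Aff, Continuous fun p : ℝ × E² => a.eval (clock P.T0 P.Tau p.1) := fun a =>
    (contDiff_affine_clock (a.v0 : ℝ) a.v1 P.T0 P.Tau (n := 0)).continuous.comp continuous_fst |>.congr
      (fun p => by simp [Aff.eval])
  have h0 : Continuous fun p : ℝ × E² => p.2 0 := (EuclideanSpace.proj (0 : Fin 2)).continuous.comp continuous_snd
  have h1 : Continuous fun p : ℝ × E² => p.2 1 := (EuclideanSpace.proj (1 : Fin 2)).continuous.comp continuous_snd
  simp only [BoxPlateau.inner, BoxQ.frzAt, mem_setOf_eq]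
  refine ((isOpen_lt ((hc B.a₀).add continuous_const) h0).inter ?_)
  refine (isOpen_lt h0 ((hc B.b₀).sub continuous_const)).inter ?_
  exact (isOpen_lt ((hc B.a₁).add continuous_const) h1).inter (isOpen_lt h1 ((hc B.b₁).sub continuous_const))

/-- **Agreement regions are open.** [folklore] -/
theorem isOpen_Agree2 (j : ℕ) : IsOpen (P.Agree2 j) := by
  refine (P.toPhase.isOpen_Agree j).inter ?_
  have e : {p : ℝ × E² | p.2 ∈ ((P.node j).box.frzAt (clock P.T0 P.Tau p.1)).inner ∧
      p.2 ∈ ((P.node (j + 1)).box.frzAt (clock P.T0 P.Tau p.1)).inner} =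
      {p | p.2 ∈ ((P.node j).box.frzAt (clock P.T0 P.Tau p.1)).inner} ∩
        {p | p.2 ∈ ((P.node (j + 1)).box.frzAt (clock P.T0 P.Tau p.1)).inner} := by ext p; simp
  rw [e]
  exact (P.isOpen_innerST _).inter (P.isOpen_innerST _)

/-- **Sheared junction test** of junction `j`: nothing for two first-layer elements; for an `identical`
junction of second-layer elements, equality; for a `forms` junction touching a sheared node, the side
test of that node against the partner's box — unless both are sheared with the same shear, frame,
material map and stream offsets and the same rational line data (the middle junction of a sheared
pair), where the two fields are literally the same on the slab. [folklore] -/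
def shJuncOKB (P : PhaseQ2) (j : ℕ) : Bool :=
  match (P.node j).ann.jkind with
  | .identical =>
    match (P.node j).e, (P.node (j + 1)).e with
    | .base _, .base _ => true
    | .base _, .sdg _ => false
    | .sdg _, .base _ => false
    | .sdg s, .sdg s' => decide (s = s')
  | .forms mT mΞ mT' mΞ' za zb za' zb' =>
    match (P.node j).e, (P.node (j + 1)).e with
    | .base _, .base _ => true
    | .base _, .sdg s' => s'.shSideOKB mT' mΞ' za' zb' (P.node j).box
    | .sdg s, .base _ => s.shSideOKB mT mΞ za zb (P.node (j + 1)).box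
    | .sdg s, .sdg s' =>
      (decide (s.sh = s'.sh) && decide (s.d.o = s'.d.o) && decide (s.d.Ξ = s'.d.Ξ) && decide (s.d.cR = s'.d.cR) &&
          decide (s.d.cK = s'.d.cK) && decide ((s.lineData mT).isSome) && decide (s.lineData mT = s'.lineData mT')) ||
        (s.shSideOKB mT mΞ za zb (P.node (j + 1)).box && s'.shSideOKB mT' mΞ' za' zb' (P.node j).box)

/-- **Junction check of a second-layer phase**: the junction check of the material view and the
sheared junction test of every junction. [folklore] -/
def agreeB2 (P : PhaseQ2) : Bool :=
  P.toPhase.agreeB && (List.range P.K).all fun j => !decide (j + 1 < P.K) || P.shJuncOKB j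

variable {P}

/-- **Two sheared nodes with the same shear, frame, material map, offsets and line data have the same
fields on the common part of their line gaps.** [folklore] -/
theorem _root_.Literature.Analysis.FluidPDE.PlanarKinematics.SDgQ.fields_eq_of_same {s s' : SDgQ} (hv : s.validB = true)
    (hv' : s'.validB = true) (hsh : s.sh = s'.sh) (ho : s.d.o = s'.d.o) (hΞ : s.d.Ξ = s'.d.Ξ) (hR : s.d.cR = s'.d.cR)
    (hK : s.d.cK = s'.d.cK) {mT mT' : ℕ} {C W : ℚ} (hL : s.lineData mT = some (C, W)) (hL' : s'.lineData mT' = some (C, W))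
    {t₀ τ t : ℝ} {z : E²} (hg : s.d.T.InGap mT (clock t₀ τ t) ((ElemQ.dg s.d).uOf z))
    (hg' : s'.d.T.InGap mT' (clock t₀ τ t) ((ElemQ.dg s'.d).uOf z)) (G : ℝ → ℝ) :
    s.scalar t₀ τ G t z = s'.scalar t₀ τ G t z ∧ s.stream t₀ τ t z = s'.stream t₀ τ t z := by
  have hu : (ElemQ.dg s.d).uOf z = (ElemQ.dg s'.d).uOf z := by rw [ElemQ.uOf_dg, ElemQ.uOf_dg, ho]
  have hT : s.Tf ((diagFrame ((d4Frame s.d.o).app z)) 0) = s'.Tf ((diagFrame ((d4Frame s'.d.o).app z)) 0) := by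
    have h1 := SDgQ.line_eq_of_lineData hv hL hg
    have h2 := SDgQ.line_eq_of_lineData hv' hL' hg'
    simp only [ElemQ.line] at h1 h2
    rw [← ElemQ.uOf_dg, ← ElemQ.uOf_dg, SDgQ.Tf, SDgQ.Tf,
      ← Pw.cval_static (t₀ := t₀) (τ := τ) (SDgQ.static_of_validB hv) t, ← Pw.cval_static (t₀ := t₀) (τ := τ) (SDgQ.static_of_validB hv') t]
    simp only [Pw.cval]
    rw [h1, h2, hu]
  have hξ : shAbscissa (s.sh : ℝ) s.Tf (diagFrame ((d4Frame s.d.o).app z)) =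
      shAbscissa (s'.sh : ℝ) s'.Tf (diagFrame ((d4Frame s'.d.o).app z)) := by
    rw [shAbscissa_apply, shAbscissa_apply, hT, hsh, ho]
  constructor
  · rw [SDgQ.scalar, SDgQ.scalar, LinFrame.conjScalar_apply, LinFrame.conjScalar_apply, shCornerScalar, shCornerScalar,
      shGraphPullback_apply, shGraphPullback_apply, vec2_apply_one, vec2_apply_one, hξ, hT, hΞ, ho]
  · simp only [SDgQ.stream]
    rw [LinFrame.conjStream_apply, LinFrame.conjStream_apply, shCornerStream, shCornerStream, shGraphStream_apply,
      shGraphStream_apply, hξ, hT, DgQ.g, DgQ.g, hΞ, ho, hR, hK]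

/-- **The fields of consecutive elements agree on the agreement region** of a second-layer phase
passing the junction check. [folklore] -/
theorem fields_eq_of_agreeB2 (h : P.agreeB2 = true) (hv : P.elemsValidB = true) {G : ℝ → ℝ} (hGe : ∀ x, G (-x) = G x)
    {j : ℕ} (hj : j + 1 < P.K) {p : ℝ × E²} (hp : p ∈ P.Agree2 j) :
    P.Θ G (j + 1) p.1 p.2 = P.Θ G j p.1 p.2 ∧ P.H (j + 1) p.1 p.2 = P.H j p.1 p.2 := by
  simp only [agreeB2, Bool.and_eq_true, List.all_eq_true] at h
  obtain ⟨hto, hsh⟩ := h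
  have hj' : j < P.K := by omega
  have hjt : j + 1 < P.toPhase.K := by simpa using hj
  have hvt := elemsValidB_toPhase hv
  -- agreement of the material view on the slab
  have hbase := PhaseQ.fields_eq_of_agreeB (P := P.toPhase) hto hvt hGe hjt hp.1
  rw [toPhase_Θ, toPhase_Θ, toPhase_H, toPhase_H] at hbase
  -- the sheared test of this junction
  have hs := hsh j (List.mem_range.2 hj')
  simp only [hj, decide_true, Bool.not_true, Bool.false_or] at hs
  -- the junction data (material view) for the regimes
  have hall := List.all_eq_true.1 hto j (List.mem_range.2 (by simpa using hj'))
  simp only [hjt, decide_true, Bool.not_true, Bool.false_or, toPhase_node, NodeQ2.toNode_ann, NodeQ2.toNode_e] at hall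
  have hvj := validB_node hv hj'
  have hvj1 := validB_node hv hj
  simp only [PhaseQ2.Θ, PhaseQ2.H]
  set α := clock P.T0 P.Tau p.1 with hαdef
  have hαI : α ∈ Icc (0 : ℝ) 1 := clock_mem_Icc _ _ _
  have hAg := hp.1
  simp only [PhaseQ.Agree, PhaseQ.agreeFuns, toPhase_node, NodeQ2.toNode_ann, NodeQ2.toNode_e, toPhase_T0, toPhase_Tau,
    Set.mem_setOf_eq] at hAg
  obtain ⟨hin, hin'⟩ := hp.2
  cases hk : (P.node j).ann.jkind with
  | identical =>
    -- equal elements (second layer) in every configuration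
    cases he : (P.node j).e with
    | base b =>
      cases he' : (P.node (j + 1)).e with
      | base b' =>
        rw [he, he'] at hbase
        simp only [ElemQ2.toElemQ_base] at hbase
        simp only [ElemQ2.scalar_base, ElemQ2.stream_base]
        exact hbase
      | sdg s' =>
        simp [shJuncOKB, hk, he, he'] at hs
    | sdg s =>
      cases he' : (P.node (j + 1)).e with
      | base b' => simp [shJuncOKB, hk, he, he'] at hs
      | sdg s' =>
        simp only [shJuncOKB, hk, he, he', decide_eq_true_eq] at hs
        subst hs
        exact ⟨rfl, rfl⟩
  | forms mT mΞ mT' mΞ' za zb za' zb' =>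
    rw [hk] at hall hAg
    simp only at hall hAg
    -- abscissa intervals from the slab
    have huI : (P.node j).e.toElemQ.uOf p.2 ∈ Icc (za.eval α) (zb.eval α) :=
      PhaseQ.uOf_mem_of_slabFuns fun φ hφ => hAg φ (List.mem_append_left _ hφ)
    have huI' : (P.node (j + 1)).e.toElemQ.uOf p.2 ∈ Icc (za'.eval α) (zb'.eval α) :=
      PhaseQ.uOf_mem_of_slabFuns fun φ hφ => hAg φ (List.mem_append_right _ hφ)
    -- line gaps from the side checks of the material view
    have hside : (P.node j).e.toElemQ.LineGap mT α ((P.node j).e.toElemQ.uOf p.2) ∧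
        (P.node (j + 1)).e.toElemQ.LineGap mT' α ((P.node (j + 1)).e.toElemQ.uOf p.2) := by
      simp only [ElemQ.agreeJB, ElemQ.sideOKB, Bool.and_eq_true, decide_eq_true_eq] at hall
      obtain ⟨⟨⟨⟨⟨⟨hl, _⟩, _⟩, ⟨⟨hl', _⟩, _⟩⟩, _⟩, _⟩, _⟩ := hall
      exact ⟨ElemQ.lineGap_of_regOK _ (ElemQ.regOK_of_regOKB _ hl hαI) huI,
        ElemQ.lineGap_of_regOK _ (ElemQ.regOK_of_regOKB _ hl' hαI) huI'⟩
    cases he : (P.node j).e with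
    | base b =>
      cases he' : (P.node (j + 1)).e with
      | base b' =>
        rw [he, he'] at hbase
        simp only [ElemQ2.toElemQ_base] at hbase
        simp only [ElemQ2.scalar_base, ElemQ2.stream_base]
        exact hbase
      | sdg s' =>
        rw [he, he'] at hbase hside; rw [he'] at huI'
        simp only [shJuncOKB, hk, he, he'] at hs
        simp only [ElemQ2.toElemQ_base, ElemQ2.toElemQ_sdg] at hbase hside huI'
        have hf := SDgQ.fields_eq_d_of_shSideOKB (t₀ := P.T0) (τ := P.Tau) (t := p.1) (hvj1' he') hs hside.2 huI' hin G
        simp only [ElemQ2.scalar_base, ElemQ2.stream_base, ElemQ2.scalar_sdg, ElemQ2.stream_sdg]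
        rw [hf.1, hf.2]
        exact hbase
    | sdg s =>
      cases he' : (P.node (j + 1)).e with
      | base b' =>
        rw [he, he'] at hbase hside; rw [he] at huI
        simp only [shJuncOKB, hk, he, he'] at hs
        simp only [ElemQ2.toElemQ_base, ElemQ2.toElemQ_sdg] at hbase hside huI
        have hf := SDgQ.fields_eq_d_of_shSideOKB (t₀ := P.T0) (τ := P.Tau) (t := p.1) (hvj' he) hs hside.1 huI hin' G
        simp only [ElemQ2.scalar_base, ElemQ2.stream_base, ElemQ2.scalar_sdg, ElemQ2.stream_sdg]
        rw [hf.1, hf.2]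
        exact hbase
      | sdg s' =>
        rw [he, he'] at hbase hside; rw [he] at huI; rw [he'] at huI'
        simp only [shJuncOKB, hk, he, he'] at hs
        simp only [ElemQ2.toElemQ_sdg] at hbase hside huI huI'
        simp only [ElemQ2.scalar_sdg, ElemQ2.stream_sdg]
        simp only [Bool.or_eq_true, Bool.and_eq_true, decide_eq_true_eq] at hs
        rcases hs with ⟨⟨⟨⟨⟨⟨hsh', ho⟩, hΞ⟩, hR⟩, hK⟩, hsome⟩, hLL⟩ | ⟨hs1, hs2⟩
        · obtain ⟨CW, hCW⟩ := Option.isSome_iff_exists.1 hsome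
          obtain ⟨C, W⟩ := CW
          have hCW' : s'.lineData mT' = some (C, W) := by rw [← hLL]; exact hCW
          have hf := SDgQ.fields_eq_of_same (t₀ := P.T0) (τ := P.Tau) (t := p.1) (z := p.2) (hvj' he) (hvj1' he') hsh' ho hΞ hR hK
            hCW hCW' hside.1 hside.2 G
          exact ⟨hf.1.symm, hf.2.symm⟩
        · have hf := SDgQ.fields_eq_d_of_shSideOKB (t₀ := P.T0) (τ := P.Tau) (t := p.1) (hvj' he) hs1 hside.1 huI hin' G
          have hf' := SDgQ.fields_eq_d_of_shSideOKB (t₀ := P.T0) (τ := P.Tau) (t := p.1) (hvj1' he') hs2 hside.2 huI' hin G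
          rw [hf.1, hf.2, hf'.1, hf'.2]
          exact hbase
  where
    /-- validity of a sheared node `j` -/
    hvj' {s : SDgQ} (he : (P.node j).e = .sdg s) : s.validB = true := by
      have h := validB_node hv (show j < P.K by omega); rw [he] at h; exact h
    /-- validity of a sheared node `j + 1` -/
    hvj1' {s : SDgQ} (he : (P.node (j + 1)).e = .sdg s) : s.validB = true := by
      have h := validB_node hv hj; rw [he] at h; exact h

/-- **Agreement of a second-layer phase** passing the junction check. [folklore] -/
theorem agreement_of_agreeB2 (h : P.agreeB2 = true) (hv : P.elemsValidB = true) {G : ℝ → ℝ} (hGe : ∀ x, G (-x) = G x) :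
    P.chain.Agreement (P.Θ G) P.H P.Agree2 where
  isOpen j _ := P.isOpen_Agree2 j
  scalar _ hj _ hp := (fields_eq_of_agreeB2 h hv hGe (by simpa using hj) hp).1
  stream _ hj _ hp := (fields_eq_of_agreeB2 h hv hGe (by simpa using hj) hp).2

/-! ### The interior facts of a checked second-layer phase -/

/-- The frame coefficients of the proxy and of the material view agree (both are those of the frame
of the data). [folklore] -/
theorem _root_.Literature.Analysis.FluidPDE.PlanarKinematics.ElemQ2.uC_geo (e : ElemQ2) : e.geo.uC = e.toElemQ.uC := by
  cases e with
  | base b => rfl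
  | sdg s => rfl

variable (P) in
/-- **The agreement slabs of the proxy are those of the material view** (same annotations, same frame
coefficients). [folklore] -/
theorem geoPhase_Agree (j : ℕ) : P.geoPhase.Agree j = P.toPhase.Agree j := by
  simp only [PhaseQ.Agree, PhaseQ.agreeFuns, geoPhase_node, toPhase_node, NodeQ2.geo_ann, NodeQ2.toNode_ann, NodeQ2.geo_e,
    NodeQ2.toNode_e, geoPhase_T0, geoPhase_Tau, toPhase_T0, toPhase_Tau, PhaseQ.slabFuns, ElemQ2.uC_geo]

/-- **Cover of a band point by the core or by a cut junction inside an agreement region**, for a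
second-layer phase whose proxy passes the geometric check. [folklore] -/
theorem cover2_of_geomB (hg : P.geoPhase.geomB = true) (t : ℝ) {z : E²} (hQ : ∀ j, 0 ≤ z j ∧ z j ≤ 1) {k : ℕ}
    (hk : k < P.geoPhase.chain.K) (hp : (t, z) ∈ P.geoPhase.chain.tubeBox k ∩ P.geoPhase.Band k) :
    (t, z) ∈ P.geoPhase.chain.core k ∨ (0 < k ∧ (t, z) ∈ P.geoPhase.chain.juncCut (k - 1) ∩ P.Agree2 (k - 1)) ∨
      (k + 1 < P.geoPhase.chain.K ∧ (t, z) ∈ P.geoPhase.chain.juncCut k ∩ P.Agree2 k) := by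
  have hk' : k < P.geoPhase.K := by simpa using hk
  rcases PhaseQ.cover_of_geomB hg t hQ hk' hp with hc | ⟨h0, hj⟩ | ⟨h1, hj⟩
  · exact Or.inl hc
  · refine Or.inr (Or.inl ⟨h0, hj.1, ?_, ?_⟩)
    · rw [← geoPhase_Agree]; exact hj.2
    · have hm := (PhaseQ.mem_juncCut_iff (P := P.geoPhase) (k - 1) (t, z)).1 hj.1
      simp only [geoPhase_node, NodeQ2.geo_box, geoPhase_T0, geoPhase_Tau] at hm
      have e : k - 1 + 1 = k := by omega
      rw [e] at hm
      refine ⟨hm.1.1, ?_⟩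
      rw [e]; exact hm.1.2
  · refine Or.inr (Or.inr ⟨by simpa using h1, hj.1, ?_, ?_⟩)
    · rw [← geoPhase_Agree]; exact hj.2
    · have hm := (PhaseQ.mem_juncCut_iff (P := P.geoPhase) k (t, z)).1 hj.1
      simp only [geoPhase_node, NodeQ2.geo_box, geoPhase_T0, geoPhase_Tau] at hm
      exact hm.1

/-- Validity from the geometric check of the proxy and the validity of the second-layer elements: the
geometric check is read on the proxy, so the validity of the SHEARED data is a separate (decidable)
hypothesis `elemsValidB`. [folklore] -/
theorem elemsValidB_geoPhase_of_geomB (hg : P.geoPhase.geomB = true) : P.geoPhase.elemsValidB = true :=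
  PhaseQ.elemsValidB_of_geomB hg

/-- **Transport on all times and the closed square** for a checked second-layer phase. [folklore] -/
theorem transport_of_checks2 {G : ℝ → ℝ} {M : ℝ} (hG : ContDiff ℝ ∞ G) (hM : ∀ q, |G q| ≤ M) (hM0 : 0 ≤ M)
    (hG0 : ∀ q, G q ≠ 0 → |q| < P.r₀) (hGe : ∀ x, G (-x) = G x) (hv : P.elemsValidB = true)
    (hg : P.geoPhase.geomB = true) (hsep : P.geoPhase.boxSepB = true) (ha : P.agreeB2 = true) (t : ℝ) {z : E²}
    (hz : ∀ j, 0 ≤ z j ∧ z j ≤ 1) :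
    deriv (fun s => P.scalar G s z) t + fderiv ℝ (P.scalar G t) z (P.velocity t z) = 0 :=
  (PhaseQ.wfbd_of_geomB hg hsep).transport_move (S := Set.univ) (Q := {z : E² | ∀ j, 0 ≤ z j ∧ z j ≤ 1}) (H₀ := 0)
    (P.facts hG hM hM0 hG0 hv) (agreement_of_agreeB2 ha hv hGe)
    (fun t _ _ hz _ hk hp => cover2_of_geomB hg t hz hk hp) t (Set.mem_univ t) z hz

/-- **The bound `|Θ| ≤ M` on all times and the closed square** for a checked second-layer phase.
[folklore] -/
theorem abs_scalar_le_of_checks2 {G : ℝ → ℝ} {M : ℝ} (hG : ContDiff ℝ ∞ G) (hM : ∀ q, |G q| ≤ M) (hM0 : 0 ≤ M)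
    (hG0 : ∀ q, G q ≠ 0 → |q| < P.r₀) (hGe : ∀ x, G (-x) = G x) (hv : P.elemsValidB = true)
    (hg : P.geoPhase.geomB = true) (hsep : P.geoPhase.boxSepB = true) (ha : P.agreeB2 = true) (t : ℝ) {z : E²}
    (hz : ∀ j, 0 ≤ z j ∧ z j ≤ 1) : |P.scalar G t z| ≤ M :=
  (PhaseQ.wfbd_of_geomB hg hsep).abs_scalar_le (S := Set.univ) (Q := {z : E² | ∀ j, 0 ≤ z j ∧ z j ≤ 1})
    (P.facts hG hM hM0 hG0 hv) (agreement_of_agreeB2 ha hv hGe)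
    (fun t _ _ hz _ hk hp => cover2_of_geomB hg t hz hk hp) t (Set.mem_univ t) z hz

/-- **Junction agreement of the scalars on the cut junctions** of a second-layer phase passing its
junction check. [folklore] -/
theorem scalar_juncCut_of_agreeB2 {G : ℝ → ℝ} (hGe : ∀ x, G (-x) = G x) (ha : P.agreeB2 = true) (hv : P.elemsValidB = true) :
    ∀ k, k + 1 < P.K → ∀ p ∈ P.chain.juncCut k ∩ P.Agree2 k, P.Θ G (k + 1) p.1 p.2 = P.Θ G k p.1 p.2 :=
  fun _ hk _ hp => (fields_eq_of_agreeB2 ha hv hGe hk hp.2).1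

/-- **Both fields vanish off the current support boxes** (all times). [folklore] -/
theorem fields_eq_zero_off_boxes2 {G : ℝ → ℝ} (hg : P.geoPhase.geomB = true) (hsep : P.geoPhase.boxSepB = true) {t : ℝ} {z : E²}
    (hz : ∀ k < P.K, z ∉ ((P.node k).box.frzAt (clock P.T0 P.Tau t)).supp) :
    P.scalar G t z = 0 ∧ P.velocity t z = 0 := by
  have hw := PhaseQ.wfbd_of_geomB hg hsep
  have hz' : ∀ k < P.geoPhase.K, z ∉ ((P.geoPhase.node k).box.frzAt (clock P.geoPhase.T0 P.geoPhase.Tau t)).supp := by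
    intro k hk; simpa using hz k (by simpa using hk)
  exact ⟨hw.scalar_eq_zero_off_boxes hz', hw.velocity_eq_zero_off_boxes hz'⟩

end PhaseQ2

end PlanarKinematics

end Literature.Analysis.FluidPDE
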